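import Summits.QuantumFields.YangMills.Theses.ConvexGribovBody

/-!
# `ConvexGribovBody.BrascampLiebVacuum` implies its route-choice repair `BrascampLiebVacuumSC`

Weakening certificate between two items of route `ConvexGribovBody` (kernel-checked bookkeeping for
the planner; prover seat of the held support item stmt-QuantumFields-8779):
the original rank-2 item `BrascampLiebVacuum` (stmt-QuantumFields-8779: every compact simple `G`,
`∃ C` BEFORE `∀ β ≥ β₀`) implies the load-bearing crux `BrascampLiebVacuumSC`
(stmt-QuantumFields-16404: `SimplyConnectedSpace G →` added, `∃ C` AFTER `∀ β ≥ β₀`, body verbatim).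
The proof is pure quantifier logic (drop the simple-connectivity hypothesis, commute `∃ C` inward);
the two `let`-bodies are syntactically identical, so no unfolding is needed.

Consequences. (1) Any proof of 8779 closes 16404 by composition with this lemma; (2) any refutation
of 16404 refutes 8779 (contrapositive, `not_brascampLiebVacuum_of_not_SC`); (3) together with the
landed negative lemma `Negative.brascampLiebVacuum_false_of_sliceBottleneck : SliceBottleneck →
¬ BrascampLiebVacuum` this records that 8779 is the STRONGER and (modulo `SliceBottleneck`) false
member of the pair, i.e. it is subsumed by 16404 for the purposes of `closes`.
-/

namespace Summit.QuantumFields.YangMills.Theorems.BrascampLiebVacuum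

open Summit.QuantumFields.YangMills.Theses.ConvexGribovBody

/-- **Weakening certificate.** The held item `BrascampLiebVacuum` (all compact simple `G`,
β-uniform constant `C`) implies the restated crux `BrascampLiebVacuumSC` (simply-connected `G`,
constant chosen after `β`): forget `SimplyConnectedSpace G` and move `∃ C` inside `∀ β ≥ β₀`.
[folklore] -/
theorem brascampLiebVacuumSC_of_brascampLiebVacuum :
    BrascampLiebVacuum → BrascampLiebVacuumSC := by
  intro h G _ _ _ _ _ _ hG _ r
  obtain ⟨C, hC, β₀, hβ⟩ := h G hG r
  exact ⟨β₀, fun β hle => ⟨C, hC, hβ β hle⟩⟩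

/-- **Contrapositive form**: a refutation of the restated crux `BrascampLiebVacuumSC` refutes the
original item `BrascampLiebVacuum`. [folklore] -/
theorem not_brascampLiebVacuum_of_not_SC :
    ¬ BrascampLiebVacuumSC → ¬ BrascampLiebVacuum :=
  fun h hBL => h (brascampLiebVacuumSC_of_brascampLiebVacuum hBL)

end Summit.QuantumFields.YangMills.Theorems.BrascampLiebVacuum
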